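import Mathlib.Analysis.SpecialFunctions.Pow.Real

/-!
# T⁴ programme, spine node NE2 (U1a), lane P2 — «V-ONE-G SUMMABLE», file C: THE DECAY CLASS OF THE COEFFICIENT `ε⋆` —
# with `s = t = u = √η` and the small quantities `n⁻², L∕n², m₁, nLm₁, n·m ≤ η ≤ 1`, `n²p ≤ α`, file B's explicit `ε⋆` is `≤ K·√η`,
# `K` level-uniform and explicit (pure real arithmetic; model level; cell `pub-balaban`)

NE2 formalisation swarm `b2b-balaban-t4-ne2-formalise-*`, leaf prover 01 GEN 9 (`prover-b2b-balaban-t4-ne2-formalise-leaf-01-g9-0`); journal INTENT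
«V-ONE-G SUMMABLE» CLAIMS.log 2026-08-20 l.20284 (optional file C).  Mathlib only; nothing defined.

WHY.  File B (`VariationalVectorOneMinCentredReg.hONEm_centred_reg`) delivers the monotone END's `hONEm k` binder for the centred competitor with
`ρV := ScV + nsqV∘Q_k` (so `C_R = 1`) and an EXPLICIT coefficient `ε⋆(n, L, d, m, m₁, p, s, t, u; Λ, C_P, C_R, Λᵥ, C_Rᵛ, C_Pᵛ, C_Går + C_Går′, C_D + C_D′)`.
The END (`VariationalVectorEndMonotone.effV_tendsto_of_upper_geom`) wants `ε₁ k ≤ c_ε·θ^k`.  This file is the bridge, as ONE real inequality: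
 * **`epsStar_class_le`**: for `0 < η ≤ 1`, nonnegative constants, and the class `(n²)⁻¹ ≤ η`, `L∕n² ≤ η`, `m₁ ≤ η`, `n·L·m₁ ≤ η`, `n·m ≤ η`, `n²·p ≤ α`,
   file B's `ε⋆` with `s = t = u = √η` is `≤ K·√η`,
   `K = 1 + 2·((1 + 2d)(1 + C_Rᵛ) + (1 + 6·K_B)) + (25∕2)·Λᵥ·C_g`,
   `K_B = 8d·(C_Rᵛ + d·L·C_Rᵛ + C_g + 2(1+d²)·C_Pᵛ) + (d∕2)(2d·C_Rᵛ + 2d²α²·C_Pᵛ) + (d∕4)(2(2d·C_Rᵛ + 2d²α²·C_Pᵛ) + 2Λ·C_dv) + C_P·K_H·C_dv`,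
   `K_H = (d∕4 + 1∕2)·C_R(Λ+1) + 2√(2d(1+d²))·√((Λ + (d∕4 + 1∕2)·C_R(Λ+1))·C_P(Λ+1)) + 2d(1+d²)·C_P(Λ+1) + 2√d·√(Λ·C_P(Λ+1))`
   — so along the tower, with `η_k = c·θ₀^{2k} ≤ 1`, `ε⋆_k ≤ K√c·θ₀^k`: the geometric shape of `effV_tendsto_of_upper_geom`'s `hε₁`.
The left-hand side is LETTER FOR LETTER file B's `let ε` (its `let e₂`, `let eH` inlined) with `s, t, u ↦ √η`, `C_g = C_Går + C_Går′`, `C_dv = C_D + C_D′`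
kept as single letters (instantiate `Cg := CGar + CGar'`, `Cdv := CD + CD'`).

HONEST FRAMING (T4-DAG p. 1).  Pure real arithmetic about OUR coefficient; the class (`m₁, nLm₁, n·m = O(L∕n)`, `n²p = O(1)`) is the road's taxi ∕ adapted-frame
class STATED, not derived here; [folklore]; no `def`, no `sorry`; axioms standard.  V-END with background ∕ NE2 NOT proved; NE3 OPEN; spine PROVED 0∕9 unchanged;
rung (B)+1 on a fixed finite T⁴ — NOT infinite volume, NOT mass gap, NOT Clay.  HONEST DEPENDENCY (cell, verbatim): continuum YM on T⁴ ⇐ BetaPertH ∧ nine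
spine estimates (0/9 proved); BetaPertH ⇐ (D1) ∧ (D4) ∧ CAP+tail; G-an2-4 gates asym, D1 and NE2/3/4.
-/

noncomputable section

namespace Summit.QuantumFields.BalabanUV.T4Continuum.VariationalVectorOneMinCentredRegClass

/-- `(1 + (√η)⁻¹)·η = η + √η` for `η > 0`. [folklore] -/
theorem one_add_inv_sqrt_mul {η : ℝ} (hη : 0 < η) : (1 + (Real.sqrt η)⁻¹) * η = η + Real.sqrt η := by
  have hs : 0 < Real.sqrt η := Real.sqrt_pos.mpr hη
  have e : (Real.sqrt η)⁻¹ * η = Real.sqrt η := by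
    rw [inv_mul_eq_div, Real.div_sqrt]
  rw [add_mul, one_mul, e]

/-- **`e_H ≤ η·K_H`** in the class. [folklore] -/
theorem eH_class_le {η d L n m m₁ Λ CP CR : ℝ}
    (hη : 0 < η) (hη1 : η ≤ 1) (hd : 0 ≤ d) (hn : 0 < n) (hm₁ : 0 ≤ m₁) (hΛ : 0 ≤ Λ) (hCP : 0 ≤ CP) (hCR : 0 ≤ CR)
    (c2 : L / n ^ 2 ≤ η) (c4 : n * L * m₁ ≤ η) (c5 : n * m ≤ η) (hL : 0 ≤ L) :
    (d / 4 + 1 / 2) * (L / n ^ 2) * CR * (Λ + 1)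
        + 2 * (Real.sqrt (2 * d * (1 + d ^ 2)) * (n * L * m₁)) * Real.sqrt ((Λ + (d / 4 + 1 / 2) * (L / n ^ 2) * CR * (Λ + 1)) * (CP * (Λ + 1)))
        + (Real.sqrt (2 * d * (1 + d ^ 2)) * (n * L * m₁)) ^ 2 * (CP * (Λ + 1))
        + 2 * (Real.sqrt d * (n * m)) * Real.sqrt (Λ * (CP * (Λ + 1)))
      ≤ η * ((d / 4 + 1 / 2) * CR * (Λ + 1) + 2 * Real.sqrt (2 * d * (1 + d ^ 2)) * Real.sqrt ((Λ + (d / 4 + 1 / 2) * CR * (Λ + 1)) * (CP * (Λ + 1)))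
          + 2 * d * (1 + d ^ 2) * (CP * (Λ + 1)) + 2 * Real.sqrt d * Real.sqrt (Λ * (CP * (Λ + 1)))) := by
  have hη0 : 0 ≤ η := hη.le
  have s4 : 0 ≤ n * L * m₁ := by positivity
  have hηη : η * η ≤ η := mul_le_of_le_one_right hη0 hη1
  have hnLm : (n * L * m₁) ^ 2 ≤ η := by rw [sq]; exact (mul_le_mul c4 c4 s4 hη0).trans hηη
  have hX : Real.sqrt ((Λ + (d / 4 + 1 / 2) * (L / n ^ 2) * CR * (Λ + 1)) * (CP * (Λ + 1)))
      ≤ Real.sqrt ((Λ + (d / 4 + 1 / 2) * CR * (Λ + 1)) * (CP * (Λ + 1))) := by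
    refine Real.sqrt_le_sqrt (mul_le_mul_of_nonneg_right ?_ (by positivity))
    have : (d / 4 + 1 / 2) * (L / n ^ 2) * CR * (Λ + 1) ≤ (d / 4 + 1 / 2) * 1 * CR * (Λ + 1) := by gcongr; exact c2.trans hη1
    linarith
  have t1 : (d / 4 + 1 / 2) * (L / n ^ 2) * CR * (Λ + 1) ≤ η * ((d / 4 + 1 / 2) * CR * (Λ + 1)) := by
    have := mul_le_mul_of_nonneg_left c2 (by positivity : 0 ≤ (d / 4 + 1 / 2) * CR * (Λ + 1)); linarith [this]
  have t2 : 2 * (Real.sqrt (2 * d * (1 + d ^ 2)) * (n * L * m₁)) * Real.sqrt ((Λ + (d / 4 + 1 / 2) * (L / n ^ 2) * CR * (Λ + 1)) * (CP * (Λ + 1)))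
      ≤ η * (2 * Real.sqrt (2 * d * (1 + d ^ 2)) * Real.sqrt ((Λ + (d / 4 + 1 / 2) * CR * (Λ + 1)) * (CP * (Λ + 1)))) := by
    have h1 : 2 * (Real.sqrt (2 * d * (1 + d ^ 2)) * (n * L * m₁)) ≤ 2 * (Real.sqrt (2 * d * (1 + d ^ 2)) * η) := by gcongr
    calc _ ≤ 2 * (Real.sqrt (2 * d * (1 + d ^ 2)) * η) * Real.sqrt ((Λ + (d / 4 + 1 / 2) * CR * (Λ + 1)) * (CP * (Λ + 1))) :=
          mul_le_mul h1 hX (Real.sqrt_nonneg _) (by positivity)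
      _ = _ := by ring
  have t3 : (Real.sqrt (2 * d * (1 + d ^ 2)) * (n * L * m₁)) ^ 2 * (CP * (Λ + 1)) ≤ η * (2 * d * (1 + d ^ 2) * (CP * (Λ + 1))) := by
    rw [mul_pow, Real.sq_sqrt (by positivity)]
    have := mul_le_mul_of_nonneg_left hnLm (by positivity : 0 ≤ 2 * d * (1 + d ^ 2) * (CP * (Λ + 1)))
    linarith [this]
  have t4 : 2 * (Real.sqrt d * (n * m)) * Real.sqrt (Λ * (CP * (Λ + 1))) ≤ η * (2 * Real.sqrt d * Real.sqrt (Λ * (CP * (Λ + 1)))) := by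
    have := mul_le_mul_of_nonneg_left c5 (by positivity : 0 ≤ 2 * Real.sqrt d * Real.sqrt (Λ * (CP * (Λ + 1))))
    linarith [this]
  linarith [t1, t2, t3, t4]

/-- **the bracket `B ≤ η·K_B`** in the class (`K_H` any number with `e_H ≤ η·K_H`). [folklore] -/
theorem bracket_class_le {η α d L n m m₁ p Λ CP CR CRv CPv Cg Cdv KH : ℝ}
    (hη : 0 < η) (hη1 : η ≤ 1) (hd : 0 ≤ d) (hL : 0 ≤ L) (hn : 0 < n) (hm₁ : 0 ≤ m₁) (hp : 0 ≤ p)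
    (hΛ : 0 ≤ Λ) (hCP : 0 ≤ CP) (hCRv : 0 ≤ CRv) (hCPv : 0 ≤ CPv) (hCg : 0 ≤ Cg) (hCdv : 0 ≤ Cdv)
    (c1 : (n ^ 2)⁻¹ ≤ η) (c3 : m₁ ≤ η) (c4 : n * L * m₁ ≤ η) (c6 : n ^ 2 * p ≤ α)
    (hH : (d / 4 + 1 / 2) * (L / n ^ 2) * CR * (Λ + 1)
        + 2 * (Real.sqrt (2 * d * (1 + d ^ 2)) * (n * L * m₁)) * Real.sqrt ((Λ + (d / 4 + 1 / 2) * (L / n ^ 2) * CR * (Λ + 1)) * (CP * (Λ + 1)))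
        + (Real.sqrt (2 * d * (1 + d ^ 2)) * (n * L * m₁)) ^ 2 * (CP * (Λ + 1))
        + 2 * (Real.sqrt d * (n * m)) * Real.sqrt (Λ * (CP * (Λ + 1))) ≤ η * KH) :
    8 * d * ((n ^ 2)⁻¹ * CRv + (1 + m₁) ^ 2 * (d / 4 * L * ((n ^ 2)⁻¹ * CRv)) + m₁ ^ 2 * Cg + m₁ ^ 2 * (2 * (1 + d ^ 2) * L ^ 2 * (n ^ 2 * CPv)))
        + d / 2 * (2 * d * ((n ^ 2)⁻¹ * CRv) + 2 * d ^ 2 * p ^ 2 * (n ^ 2 * CPv))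
        + d / 4 * (2 * (2 * d * ((n ^ 2)⁻¹ * CRv) + 2 * d ^ 2 * p ^ 2 * (n ^ 2 * CPv)) + 2 * (Λ * (n ^ 2)⁻¹ * Cdv))
        + CP * ((d / 4 + 1 / 2) * (L / n ^ 2) * CR * (Λ + 1)
        + 2 * (Real.sqrt (2 * d * (1 + d ^ 2)) * (n * L * m₁)) * Real.sqrt ((Λ + (d / 4 + 1 / 2) * (L / n ^ 2) * CR * (Λ + 1)) * (CP * (Λ + 1)))
        + (Real.sqrt (2 * d * (1 + d ^ 2)) * (n * L * m₁)) ^ 2 * (CP * (Λ + 1))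
        + 2 * (Real.sqrt d * (n * m)) * Real.sqrt (Λ * (CP * (Λ + 1)))) * Cdv
      ≤ η * (8 * d * (CRv + d * L * CRv + Cg + 2 * (1 + d ^ 2) * CPv) + d / 2 * (2 * d * CRv + 2 * d ^ 2 * α ^ 2 * CPv)
          + d / 4 * (2 * (2 * d * CRv + 2 * d ^ 2 * α ^ 2 * CPv) + 2 * (Λ * Cdv)) + CP * KH * Cdv) := by
  have hη0 : 0 ≤ η := hη.le
  have s1 : 0 ≤ (n ^ 2)⁻¹ := by positivity
  have s4 : 0 ≤ n * L * m₁ := by positivity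
  have hηη : η * η ≤ η := mul_le_of_le_one_right hη0 hη1
  have hpn : p ^ 2 * n ^ 2 ≤ α ^ 2 * η := by
    have h1 : (n ^ 2 * p) ^ 2 ≤ α ^ 2 := pow_le_pow_left₀ (by positivity) c6 2
    have e : p ^ 2 * n ^ 2 = (n ^ 2 * p) ^ 2 * (n ^ 2)⁻¹ := by field_simp
    rw [e]
    exact mul_le_mul h1 c1 s1 (by positivity)
  have hm1sq : (1 + m₁) ^ 2 ≤ 4 := by
    have h : 1 + m₁ ≤ 2 := by linarith [c3.trans hη1]
    nlinarith [h, hm₁]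
  have hnLm : (n * L * m₁) ^ 2 ≤ η := by rw [sq]; exact (mul_le_mul c4 c4 s4 hη0).trans hηη
  have hm₁2 : m₁ ^ 2 ≤ η := by rw [sq]; exact (mul_le_mul c3 c3 hm₁ hη0).trans hηη
  have u1 : (n ^ 2)⁻¹ * CRv ≤ η * CRv := mul_le_mul_of_nonneg_right c1 hCRv
  have u2 : (1 + m₁) ^ 2 * (d / 4 * L * ((n ^ 2)⁻¹ * CRv)) ≤ 4 * (d / 4 * L * (η * CRv)) :=
    mul_le_mul hm1sq (by gcongr) (by positivity) (by norm_num)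
  have u3 : m₁ ^ 2 * Cg ≤ η * Cg := mul_le_mul_of_nonneg_right hm₁2 hCg
  have u4 : m₁ ^ 2 * (2 * (1 + d ^ 2) * L ^ 2 * (n ^ 2 * CPv)) ≤ η * (2 * (1 + d ^ 2) * CPv) := by
    have e : m₁ ^ 2 * (2 * (1 + d ^ 2) * L ^ 2 * (n ^ 2 * CPv)) = (n * L * m₁) ^ 2 * (2 * (1 + d ^ 2) * CPv) := by ring
    rw [e]; exact mul_le_mul_of_nonneg_right hnLm (by positivity)
  have u5 : 2 * d ^ 2 * p ^ 2 * (n ^ 2 * CPv) ≤ η * (2 * d ^ 2 * α ^ 2 * CPv) := by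
    have e : 2 * d ^ 2 * p ^ 2 * (n ^ 2 * CPv) = 2 * d ^ 2 * CPv * (p ^ 2 * n ^ 2) := by ring
    rw [e]
    have := mul_le_mul_of_nonneg_left hpn (by positivity : 0 ≤ 2 * d ^ 2 * CPv)
    linarith [this]
  have u6 : Λ * (n ^ 2)⁻¹ * Cdv ≤ η * (Λ * Cdv) := by
    have := mul_le_mul_of_nonneg_left c1 (by positivity : 0 ≤ Λ * Cdv); linarith [this]
  have u7 := mul_le_mul_of_nonneg_left (mul_le_mul_of_nonneg_right hH hCdv) hCP
  have w1 := mul_le_mul_of_nonneg_left (add_le_add (add_le_add (add_le_add u1 u2) u3) u4) (by positivity : 0 ≤ 8 * d)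
  have w2 := mul_le_mul_of_nonneg_left (add_le_add (mul_le_mul_of_nonneg_left u1 (by positivity : 0 ≤ 2 * d)) u5) (by positivity : 0 ≤ d / 2)
  have w3 := mul_le_mul_of_nonneg_left (add_le_add (mul_le_mul_of_nonneg_left
    (add_le_add (mul_le_mul_of_nonneg_left u1 (by positivity : 0 ≤ 2 * d)) u5) (by norm_num : (0 : ℝ) ≤ 2))
    (mul_le_mul_of_nonneg_left u6 (by norm_num : (0 : ℝ) ≤ 2))) (by positivity : 0 ≤ d / 4)
  linarith [w1, w2, w3, u7]

/-- **the assembly with `s = t = u = r = √η`** (abstract: `B ≤ η K_B`, `q ≤ d η`, `X ≤ (25∕4)Λᵥ C_g η`). [folklore] -/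
theorem assemble_class_le {η r d q B X CRv KB Λv Cg : ℝ} (hη : 0 < η) (hr : r = Real.sqrt η) (hη1 : η ≤ 1)
    (hd : 0 ≤ d) (hCRv : 0 ≤ CRv) (hKB : 0 ≤ KB) (hΛv : 0 ≤ Λv) (hCg : 0 ≤ Cg)
    (hB : B ≤ η * KB) (hq : q ≤ d * η) (hX : X ≤ 25 / 4 * Λv * Cg * η) :
    r + (1 + r) * ((r + (1 + r⁻¹) * q) * (1 + CRv) + (r + 3 * (1 + r⁻¹) * B)) + (1 + r⁻¹) * X
      ≤ (1 + 2 * ((1 + 2 * d) * (1 + CRv) + (1 + 6 * KB)) + 25 / 2 * Λv * Cg) * r := by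
  have hr0 : 0 < r := by rw [hr]; exact Real.sqrt_pos.mpr hη
  have hr1 : r ≤ 1 := by rw [hr]; exact Real.sqrt_le_one.mpr hη1
  have hηr : η ≤ r := by
    -- `η ≤ √η` on `[0,1]` (inlined; the tree's `…OneLoopMarginOf.le_sqrt_self` is the same fact in another cone)
    rw [hr]
    calc η = Real.sqrt (η ^ 2) := (Real.sqrt_sq hη.le).symm
      _ ≤ Real.sqrt η := Real.sqrt_le_sqrt (by nlinarith)
  have hinv : (1 + r⁻¹) * η = η + r := by rw [hr]; exact one_add_inv_sqrt_mul hη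
  have hri : 0 ≤ 1 + r⁻¹ := by positivity
  -- `3(1 + r⁻¹)B ≤ 6 K_B r`
  have hE : 3 * (1 + r⁻¹) * B ≤ 6 * KB * r := by
    have h1 := mul_le_mul_of_nonneg_left hB (by positivity : 0 ≤ 3 * (1 + r⁻¹))
    have e : 3 * (1 + r⁻¹) * (η * KB) = 3 * KB * ((1 + r⁻¹) * η) := by ring
    rw [e, hinv] at h1
    have h2 := mul_le_mul_of_nonneg_left hηr hKB
    linarith [h1, h2]
  -- `(r + (1 + r⁻¹)q)(1 + C_Rᵛ) ≤ (1 + 2d)(1 + C_Rᵛ) r`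
  have hS : (r + (1 + r⁻¹) * q) * (1 + CRv) ≤ (1 + 2 * d) * (1 + CRv) * r := by
    have h1 : (1 + r⁻¹) * q ≤ d * (η + r) := by
      calc (1 + r⁻¹) * q ≤ (1 + r⁻¹) * (d * η) := mul_le_mul_of_nonneg_left hq hri
        _ = d * ((1 + r⁻¹) * η) := by ring
        _ = d * (η + r) := by rw [hinv]
    have h3 := mul_le_mul_of_nonneg_left hηr hd
    have h2 : r + (1 + r⁻¹) * q ≤ (1 + 2 * d) * r := by linarith [h1, h3]
    exact le_of_le_of_eq (mul_le_mul_of_nonneg_right h2 (by positivity)) (by ring)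
  -- `(1 + r⁻¹)X ≤ (25∕2)Λᵥ C_g r`
  have hT : (1 + r⁻¹) * X ≤ 25 / 2 * Λv * Cg * r := by
    have h1 := mul_le_mul_of_nonneg_left hX hri
    have e : (1 + r⁻¹) * (25 / 4 * Λv * Cg * η) = 25 / 4 * Λv * Cg * ((1 + r⁻¹) * η) := by ring
    rw [e, hinv] at h1
    have h2 := mul_le_mul_of_nonneg_left hηr (mul_nonneg hΛv hCg)
    linarith [h1, h2]
  have h12 : 0 ≤ 1 + r := by positivity
  have h2 : 1 + r ≤ 2 := by linarith
  have hin := add_le_add hS (add_le_add (le_refl r) hE)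
  have hin0 : 0 ≤ (1 + 2 * d) * (1 + CRv) * r + (r + 6 * KB * r) := by positivity
  have hmid := (mul_le_mul_of_nonneg_left hin h12).trans (mul_le_mul_of_nonneg_right h2 hin0)
  linarith [hmid, hT]

/-- **THE DECAY CLASS OF `ε⋆`** (see the module docstring for `K`, `K_B`, `K_H`): file B's `ε⋆` with `s = t = u = √η` is `≤ K·√η`. [folklore] -/
theorem epsStar_class_le {η α d L n m m₁ p Λ CP CR Λv CRv CPv Cg Cdv : ℝ}
    (hη : 0 < η) (hη1 : η ≤ 1) (hd : 0 ≤ d) (hL : 0 ≤ L) (hn : 0 < n) (hm₁ : 0 ≤ m₁) (hp : 0 ≤ p)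
    (hΛ : 0 ≤ Λ) (hCP : 0 ≤ CP) (hCR : 0 ≤ CR) (hΛv : 0 ≤ Λv) (hCRv : 0 ≤ CRv) (hCPv : 0 ≤ CPv) (hCg : 0 ≤ Cg) (hCdv : 0 ≤ Cdv)
    (c1 : (n ^ 2)⁻¹ ≤ η) (c2 : L / n ^ 2 ≤ η) (c3 : m₁ ≤ η) (c4 : n * L * m₁ ≤ η) (c5 : n * m ≤ η) (c6 : n ^ 2 * p ≤ α) :
    let KH : ℝ := ((d / 4 + 1 / 2) * CR * (Λ + 1) + 2 * Real.sqrt (2 * d * (1 + d ^ 2)) * Real.sqrt ((Λ + (d / 4 + 1 / 2) * CR * (Λ + 1)) * (CP * (Λ + 1)))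
          + 2 * d * (1 + d ^ 2) * (CP * (Λ + 1)) + 2 * Real.sqrt d * Real.sqrt (Λ * (CP * (Λ + 1))))
    let KB : ℝ := (8 * d * (CRv + d * L * CRv + Cg + 2 * (1 + d ^ 2) * CPv) + d / 2 * (2 * d * CRv + 2 * d ^ 2 * α ^ 2 * CPv)
          + d / 4 * (2 * (2 * d * CRv + 2 * d ^ 2 * α ^ 2 * CPv) + 2 * (Λ * Cdv)) + CP * KH * Cdv)
    let K : ℝ := 1 + 2 * ((1 + 2 * d) * (1 + CRv) + (1 + 6 * KB)) + 25 / 2 * Λv * Cg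
    Real.sqrt η + (1 + Real.sqrt η) * ((Real.sqrt η + (1 + (Real.sqrt η)⁻¹) * (d * L / n ^ 2)) * (1 + CRv)
        + (Real.sqrt η + 3 * (1 + (Real.sqrt η)⁻¹) * (8 * d * ((n ^ 2)⁻¹ * CRv + (1 + m₁) ^ 2 * (d / 4 * L * ((n ^ 2)⁻¹ * CRv)) + m₁ ^ 2 * Cg + m₁ ^ 2 * (2 * (1 + d ^ 2) * L ^ 2 * (n ^ 2 * CPv)))
        + d / 2 * (2 * d * ((n ^ 2)⁻¹ * CRv) + 2 * d ^ 2 * p ^ 2 * (n ^ 2 * CPv))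
        + d / 4 * (2 * (2 * d * ((n ^ 2)⁻¹ * CRv) + 2 * d ^ 2 * p ^ 2 * (n ^ 2 * CPv)) + 2 * (Λ * (n ^ 2)⁻¹ * Cdv))
        + CP * ((d / 4 + 1 / 2) * (L / n ^ 2) * CR * (Λ + 1)
        + 2 * (Real.sqrt (2 * d * (1 + d ^ 2)) * (n * L * m₁)) * Real.sqrt ((Λ + (d / 4 + 1 / 2) * (L / n ^ 2) * CR * (Λ + 1)) * (CP * (Λ + 1)))
        + (Real.sqrt (2 * d * (1 + d ^ 2)) * (n * L * m₁)) ^ 2 * (CP * (Λ + 1))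
        + 2 * (Real.sqrt d * (n * m)) * Real.sqrt (Λ * (CP * (Λ + 1)))) * Cdv)))
      + (1 + (Real.sqrt η)⁻¹) * (Λv * (25 / 4 * ((n ^ 2)⁻¹ * Cg)))
      ≤ K * Real.sqrt η := by
  intro KH KB K
  have hH := eH_class_le hη hη1 hd hn hm₁ hΛ hCP hCR c2 c4 c5 hL
  have hB := bracket_class_le (Cg := Cg) (Cdv := Cdv) hη hη1 hd hL hn hm₁ hp hΛ hCP hCRv hCPv hCg hCdv c1 c3 c4 c6 hH
  have hKH0 : 0 ≤ KH := by positivity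
  have hKB0 : 0 ≤ KB := by positivity
  have hq : d * L / n ^ 2 ≤ d * η := by rw [mul_div_assoc]; exact mul_le_mul_of_nonneg_left c2 hd
  have hX : Λv * (25 / 4 * ((n ^ 2)⁻¹ * Cg)) ≤ 25 / 4 * Λv * Cg * η := by
    have := mul_le_mul_of_nonneg_left c1 (by positivity : 0 ≤ 25 / 4 * Λv * Cg); linarith [this]
  exact assemble_class_le hη rfl hη1 hd hCRv hKB0 hΛv hCg hB hq hX

end Summit.QuantumFields.BalabanUV.T4Continuum.VariationalVectorOneMinCentredRegClass

end
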